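import Literature.Geometry.Symplectic.MoserVectorFour
import Literature.Geometry.Symplectic.OrigamiFoldFirstOrder
import Literature.Geometry.Symplectic.OrigamiFoldKernelField
import HarnessLib

/-!
# The origami Moser argument, II: the Pfaffian and the Moser vector on the model `ℝ³ × ℝ`

Second file of the proof of the named fact `Literature.Geometry.Symplectic.exists_origamiCollarNormalForm`
(Cannas da Silva–Guillemin–Woodward 2000, Thm. 1) by the Moser argument of its printed proof.
The Moser flow runs on the collar `N × ℝ` of the fold, whose charts are modelled on
`F4 = ℝ³ × ℝ`; the tree's four-dimensional linear algebra (`pfaffian`, `pfaffAdjCol`, the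
cancelled Moser vector of `MoserVectorFour.lean`) lives on `ℝ⁴`.  This file transports it through
the explicit isomorphism `appendIso : ℝ³ × ℝ ≃ ℝ⁴`, `(u, t) ↦ (u₀, u₁, u₂, t)`:

* `appendIso`, its values on the frame; `toE4₂`, `toE4₁` (forms read on `ℝ⁴`);
* `pfF β` — the Pfaffian of a `2`-form on `F4` (`pfF_eq`: the explicit combination of the values
  on the frame `(e₀,0),(e₁,0),(e₂,0),(0,1)`; `pfF_eq_zero_iff`: it vanishes iff `β` is degenerate;
  `pfF_compContinuousLinearMap`: `pfF (β ∘ L) = det L · pfF β`; `contDiff_pfF`);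
* `moserVec β ν c = T⁻¹ (c⁻¹ Σ_k ν(T⁻¹ e_k) adj_k(β ∘ T⁻¹))` — the (cancelled) Moser vector:
  `moserVec_cancel` (`β(v, w) = -μ(w)` whenever `pfF β = t c`, `c ≠ 0`, `μ = t ν`),
  `plainMoser β μ = moserVec β μ (pfF β)` (`plainMoser_solves`, `plainMoser_eq_zero`,
  `plainMoser_eq_moserVec`: off `t = 0` the plain and the cancelled vectors agree),
  uniqueness `eq_of_forall_apply_eq` and naturality `plainMoser_compContinuousLinearMap`
  (`X(β ∘ L, μ ∘ L) = L⁻¹ X(β, μ)`), and the smoothness `contDiffOn_moserVec` of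
  `(β, ν, c) ↦ moserVec β ν c` on `{c ≠ 0}`.

Everything here is proved; the definitions are explicit; no facts.

## References

* A. Cannas da Silva, V. Guillemin, C. Woodward, *On the unfolding of folded symplectic
  structures*, Math. Res. Lett. 7 (2000), proof of Thm. 1. [CannasGuilleminWoodward2000]
* D. McDuff, D. Salamon, *Introduction to Symplectic Topology*, 3rd ed. (2017), §3.2.
  [McDuffSalamon2017]
-/

noncomputable section

open scoped Topology ContDiff
open Set Function

namespace Literature.Geometry.Symplectic

namespace OrigamiMoser

local notation "E3" => EuclideanSpace ℝ (Fin 3)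
local notation "E4" => EuclideanSpace ℝ (Fin 4)
local notation "F4" => EuclideanSpace ℝ (Fin 3) × ℝ

/-! ### The isomorphism `ℝ³ × ℝ ≃ ℝ⁴` -/

/-- `(u, t) ↦ (u₀, u₁, u₂, t)` as a linear map. [folklore] -/
def appendLin : F4 →ₗ[ℝ] E4 where
  toFun p := WithLp.toLp 2 ![p.1 0, p.1 1, p.1 2, p.2]
  map_add' p q := by
    ext i
    fin_cases i <;> rfl
  map_smul' c p := by
    ext i
    fin_cases i <;> rfl

/-- `v ↦ ((v₀, v₁, v₂), v₃)` as a linear map. [folklore] -/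
def unappendLin : E4 →ₗ[ℝ] F4 where
  toFun v := (WithLp.toLp 2 ![v 0, v 1, v 2], v 3)
  map_add' v w := by
    refine Prod.ext ?_ rfl
    ext i
    fin_cases i <;> rfl
  map_smul' c v := by
    refine Prod.ext ?_ rfl
    ext i
    fin_cases i <;> rfl

/-- **The isomorphism `ℝ³ × ℝ ≃L ℝ⁴`**, `(u, t) ↦ (u₀, u₁, u₂, t)`. [folklore] -/
def appendIso : F4 ≃L[ℝ] E4 :=
  (LinearEquiv.ofLinear appendLin unappendLin
    (by
      ext v i
      fin_cases i <;> rfl)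
    (by
      apply LinearMap.ext; intro p
      ext i
      · fin_cases i <;> rfl
      · rfl)).toContinuousLinearEquiv

/-- The coordinates of `appendIso (u, t)`. [folklore] -/
theorem appendIso_apply (p : F4) :
    appendIso p = WithLp.toLp 2 ![p.1 0, p.1 1, p.1 2, p.2] := rfl

/-- The first component of `appendIso⁻¹ v`. [folklore] -/
@[simp] theorem appendIso_symm_apply_fst (v : E4) :
    (appendIso.symm v).1 = WithLp.toLp 2 ![v 0, v 1, v 2] := rfl

/-- The second component of `appendIso⁻¹ v`. [folklore] -/
@[simp] theorem appendIso_symm_apply_snd (v : E4) : (appendIso.symm v).2 = v 3 := rfl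

/-- The horizontal frame vector `(e_i, 0)` of `F4`. [folklore] -/
def hVec (i : Fin 3) : F4 := (EuclideanSpace.single i (1 : ℝ), 0)

/-- The vertical frame vector `(0, 1)` of `F4`. [folklore] -/
def vVec : F4 := ((0 : E3), (1 : ℝ))

/-- `appendIso⁻¹ e₀ = (e₀, 0)`. [folklore] -/
theorem appendIso_symm_stdVec_zero : appendIso.symm (stdVec 0) = hVec 0 := by
  ext i
  · fin_cases i <;> simp [hVec, stdVec]
  · simp [hVec, stdVec]

/-- `appendIso⁻¹ e₁ = (e₁, 0)`. [folklore] -/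
theorem appendIso_symm_stdVec_one : appendIso.symm (stdVec 1) = hVec 1 := by
  ext i
  · fin_cases i <;> simp [hVec, stdVec]
  · simp [hVec, stdVec]

/-- `appendIso⁻¹ e₂ = (e₂, 0)`. [folklore] -/
theorem appendIso_symm_stdVec_two : appendIso.symm (stdVec 2) = hVec 2 := by
  ext i
  · fin_cases i <;> simp [hVec, stdVec]
  · simp [hVec, stdVec]

/-- `appendIso⁻¹ e₃ = (0, 1)`. [folklore] -/
theorem appendIso_symm_stdVec_three : appendIso.symm (stdVec 3) = vVec := by
  ext i
  · fin_cases i <;> simp [vVec, stdVec]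
  · simp [vVec, stdVec]

/-! ### Forms read on `ℝ⁴` and the Pfaffian -/

/-- A `2`-form on `F4` read on `ℝ⁴`. [folklore] -/
def toE4₂ (β : F4 [⋀^Fin 2]→L[ℝ] ℝ) : E4 [⋀^Fin 2]→L[ℝ] ℝ :=
  β.compContinuousLinearMap (appendIso.symm : E4 →L[ℝ] F4)

/-- A `1`-form on `F4` read on `ℝ⁴`. [folklore] -/
def toE4₁ (ν : F4 [⋀^Fin 1]→L[ℝ] ℝ) : E4 [⋀^Fin 1]→L[ℝ] ℝ :=
  ν.compContinuousLinearMap (appendIso.symm : E4 →L[ℝ] F4)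

/-- The values of `toE4₂ β`. [folklore] -/
@[simp] theorem toE4₂_apply (β : F4 [⋀^Fin 2]→L[ℝ] ℝ) (v w : E4) :
    toE4₂ β ![v, w] = β ![appendIso.symm v, appendIso.symm w] := by
  rw [toE4₂, ContinuousAlternatingMap.compContinuousLinearMap_apply]
  congr 1
  funext i; fin_cases i <;> rfl

/-- The values of `toE4₁ ν`. [folklore] -/
@[simp] theorem toE4₁_apply (ν : F4 [⋀^Fin 1]→L[ℝ] ℝ) (v : E4) :
    toE4₁ ν ![v] = ν ![appendIso.symm v] := by
  rw [toE4₁, ContinuousAlternatingMap.compContinuousLinearMap_apply]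
  congr 1
  funext i; fin_cases i; rfl

/-- `toE4₂` is a continuous linear map. [folklore] -/
theorem toE4₂_eq_clm (β : F4 [⋀^Fin 2]→L[ℝ] ℝ) :
    toE4₂ β = ContinuousAlternatingMap.compContinuousLinearMapCLM
      (appendIso.symm : E4 →L[ℝ] F4) β := rfl

/-- `toE4₁` is a continuous linear map. [folklore] -/
theorem toE4₁_eq_clm (ν : F4 [⋀^Fin 1]→L[ℝ] ℝ) :
    toE4₁ ν = ContinuousAlternatingMap.compContinuousLinearMapCLM
      (appendIso.symm : E4 →L[ℝ] F4) ν := rfl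

/-- `toE4₂ (t • ν) = t • toE4₂ ν`-type linearity for `1`-forms. [folklore] -/
theorem toE4₁_smul (t : ℝ) (ν : F4 [⋀^Fin 1]→L[ℝ] ℝ) : toE4₁ (t • ν) = t • toE4₁ ν := by
  rw [toE4₁_eq_clm, toE4₁_eq_clm, map_smul]

/-- **The Pfaffian of a `2`-form on `ℝ³ × ℝ`** (through `appendIso`). [folklore] -/
def pfF (β : F4 [⋀^Fin 2]→L[ℝ] ℝ) : ℝ := pfaffian (toE4₂ β)

/-- **The Pfaffian on `ℝ³ × ℝ` explicitly**, on the frame `(e₀,0),(e₁,0),(e₂,0),(0,1)`. [folklore] -/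
theorem pfF_eq (β : F4 [⋀^Fin 2]→L[ℝ] ℝ) :
    pfF β = β ![hVec 0, hVec 1] * β ![hVec 2, vVec] - β ![hVec 0, hVec 2] * β ![hVec 1, vVec] +
      β ![hVec 0, vVec] * β ![hVec 1, hVec 2] := by
  rw [pfF, toE4₂, pfaffian_compContinuousLinearMap_eq]
  simp only [ContinuousLinearEquiv.coe_coe, appendIso_symm_stdVec_zero,
    appendIso_symm_stdVec_one, appendIso_symm_stdVec_two, appendIso_symm_stdVec_three]

/-- **`pfF β = 0` iff `β` is degenerate.** [folklore] -/
theorem pfF_eq_zero_iff (β : F4 [⋀^Fin 2]→L[ℝ] ℝ) :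
    pfF β = 0 ↔ ∃ v : F4, v ≠ 0 ∧ ∀ w, β ![v, w] = 0 := by
  rw [pfF, pfaffian_eq_zero_iff]
  constructor
  · rintro ⟨v, hv, h⟩
    refine ⟨appendIso.symm v, fun h0 => hv ?_, fun w => ?_⟩
    · have h1 := congrArg appendIso h0
      rwa [ContinuousLinearEquiv.apply_symm_apply, map_zero] at h1
    · have := h (appendIso w)
      rwa [toE4₂_apply, ContinuousLinearEquiv.symm_apply_apply] at this
  · rintro ⟨v, hv, h⟩
    refine ⟨appendIso v, fun h0 => hv ?_, fun w => ?_⟩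
    · have h1 := congrArg appendIso.symm h0
      rwa [ContinuousLinearEquiv.symm_apply_apply, map_zero] at h1
    · rw [toE4₂_apply, ContinuousLinearEquiv.symm_apply_apply]
      exact h _

/-- A non-degenerate `2`-form separates vectors: if `pfF β ≠ 0` and `β(v, ·) = β(v', ·)` then
`v = v'`. [folklore] -/
theorem eq_of_forall_apply_eq {β : F4 [⋀^Fin 2]→L[ℝ] ℝ} (hβ : pfF β ≠ 0) {v v' : F4}
    (h : ∀ w, β ![v, w] = β ![v', w]) : v = v' := by
  by_contra hne
  apply hβ
  rw [pfF_eq_zero_iff]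
  refine ⟨v - v', sub_ne_zero.2 hne, fun w => ?_⟩
  rw [sub_eq_add_neg, β.vecCons_add ![w] v (-v'), ← neg_one_smul ℝ v',
    β.vecCons_smul ![w] (-1) v', h w, smul_eq_mul]
  ring

/-- **Functoriality**: `pfF (β ∘ L) = det L · pfF β`. [folklore] -/
theorem pfF_compContinuousLinearMap (β : F4 [⋀^Fin 2]→L[ℝ] ℝ) (L : F4 →L[ℝ] F4) :
    pfF (β.compContinuousLinearMap L) = LinearMap.det (L : F4 →ₗ[ℝ] F4) * pfF β := by
  have h : toE4₂ (β.compContinuousLinearMap L) =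
      (toE4₂ β).compContinuousLinearMap
        (((appendIso : F4 →L[ℝ] E4).comp L).comp (appendIso.symm : E4 →L[ℝ] F4)) := by
    ext v
    simp only [toE4₂, ContinuousAlternatingMap.compContinuousLinearMap_apply]
    congr 1
    funext i
    simp
  rw [pfF, pfF, h, pfaffian_compContinuousLinearMap]
  congr 1
  have : ((((appendIso : F4 →L[ℝ] E4).comp L).comp (appendIso.symm : E4 →L[ℝ] F4) :
      E4 →L[ℝ] E4) : E4 →ₗ[ℝ] E4) =
      (appendIso.toLinearEquiv : F4 →ₗ[ℝ] E4) ∘ₗ (L : F4 →ₗ[ℝ] F4) ∘ₗ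
        (appendIso.toLinearEquiv.symm : E4 →ₗ[ℝ] F4) := rfl
  rw [this, LinearMap.det_conj]

/-- The Pfaffian on `ℝ³ × ℝ` is a polynomial, hence `C^∞`. [folklore] -/
theorem contDiff_pfF : ContDiff ℝ ∞ (pfF : (F4 [⋀^Fin 2]→L[ℝ] ℝ) → ℝ) := by
  have h : (pfF : (F4 [⋀^Fin 2]→L[ℝ] ℝ) → ℝ) = pfaffian ∘
      (ContinuousAlternatingMap.compContinuousLinearMapCLM (appendIso.symm : E4 →L[ℝ] F4)) := by
    funext β; rfl
  rw [h]
  exact contDiff_pfaffian.comp (ContinuousLinearMap.contDiff _)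

/-! ### The Moser vector -/

/-- **The (cancelled) Moser vector** on `ℝ³ × ℝ`: `T⁻¹ (c⁻¹ Σ_k ν(T⁻¹ e_k) adj_k(β ∘ T⁻¹))`.
[cite: CannasGuilleminWoodward2000, proof of Thm. 1] -/
def moserVec (β : F4 [⋀^Fin 2]→L[ℝ] ℝ) (ν : F4 [⋀^Fin 1]→L[ℝ] ℝ) (c : ℝ) : F4 :=
  appendIso.symm (c⁻¹ • ∑ k, toE4₁ ν ![stdVec k] • pfaffAdjCol (toE4₂ β) k)

/-- **The cancelled Moser equation**: if `pfF β = t c` with `c ≠ 0` and `μ = t • ν`, then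
`β (moserVec β ν c, w) = -μ(w)` for all `w` (also at `t = 0`).
[cite: CannasGuilleminWoodward2000, proof of Thm. 1] -/
theorem moserVec_cancel {β : F4 [⋀^Fin 2]→L[ℝ] ℝ} {t c : ℝ} (hc : c ≠ 0) (hP : pfF β = t * c)
    {μ ν : F4 [⋀^Fin 1]→L[ℝ] ℝ} (hμ : μ = t • ν) (w : F4) :
    β ![moserVec β ν c, w] = -μ ![w] := by
  have h := alt_two_moserVector_cancel (toE4₂ β) hc hP (μ := toE4₁ μ) (ν := toE4₁ ν)
    (by rw [hμ, toE4₁_smul]) (appendIso w)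
  rw [toE4₂_apply, toE4₁_apply, ContinuousLinearEquiv.symm_apply_apply] at h
  exact h

/-- **The plain Moser vector** `X(β, μ)`: the cancelled vector with `t = 1`, i.e.
`(pfF β)⁻¹ Σ …` (zero when `β` is degenerate, by `0⁻¹ = 0`). [cite: McDuffSalamon2017, §3.2] -/
def plainMoser (β : F4 [⋀^Fin 2]→L[ℝ] ℝ) (μ : F4 [⋀^Fin 1]→L[ℝ] ℝ) : F4 := moserVec β μ (pfF β)

/-- The plain Moser vector solves `β(X, w) = -μ(w)` when `β` is non-degenerate.
[cite: McDuffSalamon2017, §3.2] -/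
theorem plainMoser_solves {β : F4 [⋀^Fin 2]→L[ℝ] ℝ} (hβ : pfF β ≠ 0) (μ : F4 [⋀^Fin 1]→L[ℝ] ℝ)
    (w : F4) : β ![plainMoser β μ, w] = -μ ![w] :=
  moserVec_cancel hβ (by rw [one_mul]) (by rw [one_smul]) w

/-- The plain Moser vector of a degenerate form is zero. [folklore] -/
theorem plainMoser_eq_zero {β : F4 [⋀^Fin 2]→L[ℝ] ℝ} (hβ : pfF β = 0) (μ : F4 [⋀^Fin 1]→L[ℝ] ℝ) :
    plainMoser β μ = 0 := by
  rw [plainMoser, moserVec, hβ, inv_zero, zero_smul, map_zero]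

/-- **Off `t = 0` the plain and the cancelled Moser vectors agree**: if `pfF β = t c` and
`μ = t • ν` with `t ≠ 0` then `X(β, μ) = moserVec β ν c`. [folklore] -/
theorem plainMoser_eq_moserVec {β : F4 [⋀^Fin 2]→L[ℝ] ℝ} {t c : ℝ} (ht : t ≠ 0)
    (hP : pfF β = t * c) {μ ν : F4 [⋀^Fin 1]→L[ℝ] ℝ} (hμ : μ = t • ν) :
    plainMoser β μ = moserVec β ν c := by
  by_cases hc : c = 0
  · have h0 : pfF β = 0 := by rw [hP, hc, mul_zero]
    rw [plainMoser_eq_zero h0, moserVec, hc, inv_zero, zero_smul, map_zero]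
  · rw [plainMoser, moserVec, moserVec, hP, hμ, toE4₁_smul]
    congr 1
    simp only [ContinuousAlternatingMap.smul_apply, smul_eq_mul]
    simp_rw [mul_smul]
    rw [← Finset.smul_sum, smul_smul]
    congr 1
    field_simp

/-- **Naturality of the plain Moser vector**: `X(β ∘ L, μ ∘ L) = L⁻¹ X(β, μ)` for an
isomorphism `L` (uniqueness of the solution when `β` is non-degenerate; both sides vanish when it
is degenerate). [folklore] -/
theorem plainMoser_compContinuousLinearMap (β : F4 [⋀^Fin 2]→L[ℝ] ℝ) (μ : F4 [⋀^Fin 1]→L[ℝ] ℝ)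
    (L : F4 ≃L[ℝ] F4) :
    plainMoser (β.compContinuousLinearMap (L : F4 →L[ℝ] F4))
        (μ.compContinuousLinearMap (L : F4 →L[ℝ] F4)) = L.symm (plainMoser β μ) := by
  have hdet : LinearMap.det ((L : F4 →L[ℝ] F4) : F4 →ₗ[ℝ] F4) ≠ 0 :=
    (LinearEquiv.isUnit_det' L.toLinearEquiv).ne_zero
  by_cases hβ : pfF β = 0
  · have h0 : pfF (β.compContinuousLinearMap (L : F4 →L[ℝ] F4)) = 0 := by
      rw [pfF_compContinuousLinearMap, hβ, mul_zero]
    rw [plainMoser_eq_zero hβ, plainMoser_eq_zero h0, map_zero]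
  · have hβL : pfF (β.compContinuousLinearMap (L : F4 →L[ℝ] F4)) ≠ 0 := by
      rw [pfF_compContinuousLinearMap]; exact mul_ne_zero hdet hβ
    apply eq_of_forall_apply_eq hβL
    intro w
    rw [plainMoser_solves hβL]
    have key : β.compContinuousLinearMap (L : F4 →L[ℝ] F4) ![L.symm (plainMoser β μ), w] =
        β ![plainMoser β μ, L w] := by
      rw [ContinuousAlternatingMap.compContinuousLinearMap_apply]
      congr 1
      funext i; fin_cases i
      · simp
      · rfl
    rw [key, plainMoser_solves hβ]
    rw [ContinuousAlternatingMap.compContinuousLinearMap_apply]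
    congr 2
    funext i; fin_cases i; rfl

/-! ### Smoothness of the Moser vector in its data -/

/-- Evaluation of a `1`-form at a fixed vector is `C^∞` in the form. [folklore] -/
theorem contDiff_alt_one_eval (v : Fin 1 → E4) :
    ContDiff ℝ ∞ fun ν : E4 [⋀^Fin 1]→L[ℝ] ℝ => ν v :=
  (ContinuousAlternatingMap.apply ℝ E4 ℝ v).contDiff

/-- **The Moser vector is `C^∞` in `(β, ν, c)` on `{c ≠ 0}`.** [folklore] -/
theorem contDiffOn_moserVec :
    ContDiffOn ℝ ∞ (fun x : (F4 [⋀^Fin 2]→L[ℝ] ℝ) × (F4 [⋀^Fin 1]→L[ℝ] ℝ) × ℝ =>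
      moserVec x.1 x.2.1 x.2.2) {x | x.2.2 ≠ 0} := by
  have h2 : ContDiff ℝ ∞ fun x : (F4 [⋀^Fin 2]→L[ℝ] ℝ) × (F4 [⋀^Fin 1]→L[ℝ] ℝ) × ℝ => toE4₂ x.1 := by
    simp only [toE4₂_eq_clm]
    exact (ContinuousLinearMap.contDiff _).comp contDiff_fst
  have h1 : ContDiff ℝ ∞ fun x : (F4 [⋀^Fin 2]→L[ℝ] ℝ) × (F4 [⋀^Fin 1]→L[ℝ] ℝ) × ℝ => toE4₁ x.2.1 := by
    simp only [toE4₁_eq_clm]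
    exact (ContinuousLinearMap.contDiff _).comp (contDiff_fst.comp contDiff_snd)
  have hsum : ContDiff ℝ ∞ fun x : (F4 [⋀^Fin 2]→L[ℝ] ℝ) × (F4 [⋀^Fin 1]→L[ℝ] ℝ) × ℝ =>
      ∑ k, toE4₁ x.2.1 ![stdVec k] • pfaffAdjCol (toE4₂ x.1) k := by
    refine ContDiff.sum fun k _ => ?_
    exact ((contDiff_alt_one_eval ![stdVec k]).comp h1).smul ((contDiff_pfaffAdjCol k).comp h2)
  have hinv : ContDiffOn ℝ ∞ (fun x : (F4 [⋀^Fin 2]→L[ℝ] ℝ) × (F4 [⋀^Fin 1]→L[ℝ] ℝ) × ℝ => x.2.2⁻¹)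
      {x | x.2.2 ≠ 0} :=
    (contDiff_snd.comp contDiff_snd).contDiffOn.inv fun x hx => hx
  have h := (hinv.smul hsum.contDiffOn)
  exact (appendIso.symm : E4 →L[ℝ] F4).contDiff.comp_contDiffOn h

end OrigamiMoser

end Literature.Geometry.Symplectic

end
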